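/-
Copyright (c) 2026 the pub-hodgecm-mathlib formalisation cell (harness21).  Prover seat hodgecm-mathlib-K2E4-p05 (g0): Pool-H helper H2 of the K2 · E4 line
«SingularTransferKappaSign» (dealer K2E4-plan (g0) DEAL 2026-09-03T21:04:57Z; chair K2-lead (g0)).
-/
import Literature.NumberTheory.Rogawski1990.AdelicStableClassesProductGp      -- ★ `isLocalNormPair_rationalComponent_toLocal_toAdelic`, `isArchNormPair_rationalArch_cmRationalToArch` (a rational `γ_H → γ` localises)
import Literature.NumberTheory.Rogawski1990.SingularStableClassTransfers       -- ★ `transfersTo_mk_of_fst_eq_smul_one` (the pair `(a·1₂, b)` matches a type-(2,1) class), `StableClassH.transfersTo_mk_iff`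
import HarnessLib

/-!
# K2 · E4 helper H2 — the SEMIREGULAR PAIR `(γ_H, γ₀) = ((e₁·1₂, e₂), γ₀)` MATCHES: `γ_H → γ₀` globally, at every finite place, and at infinity

Prover file `Summits/HodgeConjecture/HodgeConjecture/Theorems/K2E4SingularPairIsLocalNormPair.lean` (HCML Track B «K2-LIT», line
`Cruxes/H413/Lines/K2_E4_SingularTransferKappaSign.lean`, Pool-H helper H2 of `K2/K2E4-plan/g0/DEALS.K2E4-g0.md`; `--supports stmt-HodgeConjecture-24833`).
THEOREMS ONLY (no definition, no instance, no notation, no named fact, no `sorry`).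

THE POINT.  Every socket of the units U2–U5 of the line reads the explicit transfer factor `Δ‴_v(γ_{H,v}, γ_{0,v})` (★ `finExplicitDelta_of_isLocalNormPair`)
or the archimedean factor `Δ‴_∞(γ_H ⊗ 1, γ₀ ⊗ 1)` AT THE SEMIREGULAR PAIR of the line: a rational `γ₀ ∈ U(H′)(L⁺)` of type (2,1) — `(γ₀ − e₁)(γ₀ − e₂) = 0`,
`e₁ ≠ e₂`, `charpoly γ₀ = (X − e₁)²(X − e₂)` — and its endoscopic partner `γ_H = (e₁·1₂, e₂) ∈ H(L⁺) = U(Φ₂)(L⁺) × U(Φ₁)(L⁺)` (the `U(1)`-component pinned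
entrywise, `(γ_H.2) 0 0 = e₂`, exactly as the sockets spell it).  This file proves ONCE, for import BY NAME by the provers of sockets #2 ∕ #4 ∕ #15 ∕ #16 ∕ #17:
* `isNormPair_of_fst_eq_smul_one` — GLOBAL: `γ_H → γ₀` (★ `IsNormPair`: `ι(γ_H) = diag(e₁, e₂, e₁)` and `γ₀` are conjugate in `GL₃(L)`; both are killed by
  `(X − e₁)(X − e₂)` and have the same characteristic polynomial — ★ `transfersTo_mk_of_fst_eq_smul_one` read through ★ `StableClassH.transfersTo_mk_iff`);
* **`singularPairIsLocalNormPair`** (THE DEALT STATEMENT H2) — LOCAL: `(γ_H)_v → (γ₀)_v` (★ `IsLocalNormPair L H′ v`) at EVERY finite place `v` of `L⁺`, the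
  components written as the sockets write them (`toLocal v (toAdelic ·)` on the three `cmDatum` carriers) — ★ `isLocalNormPair_rationalComponent_toLocal_toAdelic`;
* `singularPairIsArchNormPair` — ARCHIMEDEAN: `γ_H ⊗ 1 → γ₀ ⊗ 1` (★ `IsArchNormPair`, components ★ `cmRationalToArch` as socket #15 writes them) —
  ★ `isArchNormPair_rationalArch_cmRationalToArch`;
* the one-entry bookkeeping `coe_snd_eq_smul_one_of_apply_eq` (`(γ_H.2) 0 0 = e₂ ⇒ γ_H.2 = e₂·1₁`).
DEDUP NOTE: ★ `Theorems/K2E4ExplicitSingularPairNondegenerate` (K2E4-p15) proves the GLOBAL matching inline as `isNormPair_of_scalarPartner` under the extra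
frame hypotheses `hherm`, `hanis` and non-centrality (explicit conjugator via ★ `exists_eq_conj_diagonal_of_charpoly`); the version here drops those three
hypotheses (any `H′`, two lines over ★ `transfersTo_mk_of_fst_eq_smul_one`) and adds the LOCAL and ARCHIMEDEAN readings the other sockets consume by name.
Hypotheses are the sockets' binders in the sockets' order (`γ₀ e₁ e₂`, `e₁ ≠ e₂`, `(γ₀ − e₁)(γ₀ − e₂) = 0`, `charpoly`, `γ_H`, the two pins, `v`); the sockets'
non-centrality clause `¬ ∃ ζ, γ₀ = ζ·1` and the frame (`hanis`, `hherm`, measures, `hCTM`) are NOT needed and not taken.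
[Rogawski1990 §4.3 p. 42 «`γ′ ∈ H` … `A_{G/H}(γ′)`»; §4.9 p. 54; §5.4 p. 78 (the classes of `H` over a singular `γ₀`); §14.1 p. 232 (`γ′ ↔ γ`); §3.8 Prop. 3.8.1 p. 27.]
HONEST LABEL: pure algebra over the tree's ★ carriers; proves no printed analytic statement; HC_CM is proved only modulo the 7 printed citations (2 remaining
named inputs: hLiu418 = stmt-HodgeConjecture-24832, h413 = stmt-HodgeConjecture-24833) until rung 0 closes.
-/

set_option autoImplicit false
set_option linter.dupNamespace false

noncomputable section

open NumberField IsDedekindDomain Polynomial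
open Literature.NumberTheory.Rogawski1990 Literature.NumberTheory.Automorphic
open Literature.AlgebraicGeometry.ShimuraVarieties (unitaryGroup)
open scoped Matrix MatrixGroups

namespace Summit.HodgeConjecture.HodgeConjecture.Cruxes.H413.K2E4SingularPairIsLocalNormPair

variable (L : Type) [Field L] [NumberField L] [IsCMField L] (H' : Matrix (Fin 3) (Fin 3) L)

/-- A `1 × 1` invertible matrix is the scalar given by its entry: `(u) 0 0 = e ⇒ (u) = e·1₁` (the sockets pin the `U(1)`-component of `γ_H` entrywise).
[cite: Rogawski1990, §4.8 Case (a) p. 53] -/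
theorem coe_snd_eq_smul_one_of_apply_eq {K : Type*} [Field K] (u : GL (Fin 1) K) {e : K} (hu : (u : Matrix (Fin 1) (Fin 1) K) 0 0 = e) :
    (u : Matrix (Fin 1) (Fin 1) K) = e • (1 : Matrix (Fin 1) (Fin 1) K) := by
  ext i j
  fin_cases i; fin_cases j
  simpa using hu

/-- **GLOBAL MATCHING AT THE SEMIREGULAR PAIR: `γ_H → γ₀`** (★ `IsNormPair L H′ γ_H γ₀`: `ι(γ_H) ↔ γ₀`, conjugate in `GL₃(L)`).  For `γ₀ ∈ U(H′)(L⁺)` with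
`(γ₀ − e₁)(γ₀ − e₂) = 0`, `e₁ ≠ e₂`, `charpoly γ₀ = (X − e₁)²(X − e₂)` and `γ_H = (e₁·1₂, u)` with `u 0 0 = e₂`: `ι(γ_H) = diag(e₁, e₂, e₁)` is killed by
`(X − e₁)(X − e₂)` and has characteristic polynomial `(X − e₁)²(X − e₂)`, so it is `GL₃(L)`-conjugate to `γ₀` (split semisimple classes are characteristic-polynomial
fibres, ★ `transfersTo_mk_of_fst_eq_smul_one` + ★ `StableClassH.transfersTo_mk_iff`). [cite: Rogawski1990, §5.4 p. 78; §4.3 p. 42; §3.8 Prop. 3.8.1 p. 27] -/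
theorem isNormPair_of_fst_eq_smul_one (γ₀ : (UnitaryGroup.cmDatum L 3 H').Rational) (e₁ e₂ : L) (he : e₁ ≠ e₂)
    (hγ₀ : ((((γ₀ : unitaryGroup (cmConjRingHom L) H').val : GL (Fin 3) L) : Matrix (Fin 3) (Fin 3) L) - e₁ • (1 : Matrix (Fin 3) (Fin 3) L)) *
      ((((γ₀ : unitaryGroup (cmConjRingHom L) H').val : GL (Fin 3) L) : Matrix (Fin 3) (Fin 3) L) - e₂ • (1 : Matrix (Fin 3) (Fin 3) L)) = 0)
    (hchar : (((γ₀ : unitaryGroup (cmConjRingHom L) H').val : GL (Fin 3) L) : Matrix (Fin 3) (Fin 3) L).charpoly =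
      (Polynomial.X - Polynomial.C e₁) ^ 2 * (Polynomial.X - Polynomial.C e₂))
    (γH : (UnitaryGroup.cmDatum L 2 (Matrix.of fun i j : Fin 2 => if i.val + j.val + 1 = 2 then (1 : L) else 0)).Rational ×
      (UnitaryGroup.cmDatum L 1 (Matrix.of fun i j : Fin 1 => if i.val + j.val + 1 = 1 then (1 : L) else 0)).Rational)
    (hγH₁ : (((γH.1 : unitaryGroup (cmConjRingHom L) (Matrix.of fun i j : Fin 2 => if i.val + j.val + 1 = 2 then (1 : L) else 0)).val : GL (Fin 2) L) :
        Matrix (Fin 2) (Fin 2) L) = e₁ • (1 : Matrix (Fin 2) (Fin 2) L))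
    (hγH₂ : (((γH.2 : unitaryGroup (cmConjRingHom L) (Matrix.of fun i j : Fin 1 => if i.val + j.val + 1 = 1 then (1 : L) else 0)).val : GL (Fin 1) L) :
        Matrix (Fin 1) (Fin 1) L) 0 0 = e₂) :
    IsNormPair L H' γH γ₀ :=
  (StableClassH.transfersTo_mk_iff endoForm_antidiagOne γH γ₀).mp
    (transfersTo_mk_of_fst_eq_smul_one (cmConjRingHom L) endoForm_antidiagOne he hγ₀ hchar γH hγH₁ (coe_snd_eq_smul_one_of_apply_eq _ hγH₂))

/-- **H2 — LOCAL MATCHING AT THE SEMIREGULAR PAIR, EVERY FINITE PLACE: `(γ_H)_v → (γ₀)_v`** (★ `IsLocalNormPair L H′ v`: `ι_v((γ_H)_v) ↔ (γ₀)_v` in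
`GL₃(∏_{w∣v} L_w)`), the components spelled as in the sockets of the line (`toLocal v (toAdelic ·)` on the `cmDatum` carriers of `U(Φ₂)`, `U(Φ₁)`, `U(H′)`).
The global matching `isNormPair_of_fst_eq_smul_one` localises (★ `isLocalNormPair_rationalComponent_toLocal_toAdelic`: `IsConj` pushed along `L → 𝔸_L → ∏_{w∣v} L_w`,
`(ι γ_H)_v = ι_v((γ_H)_v)`).  Consumers: sockets #2, #4, #15, #16, #17 (★ `finExplicitDelta_of_isLocalNormPair` at the pair).
[cite: Rogawski1990, §4.3 p. 43; §14.1 p. 232; §5.4 p. 78] -/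
theorem singularPairIsLocalNormPair (γ₀ : (UnitaryGroup.cmDatum L 3 H').Rational) (e₁ e₂ : L) (he : e₁ ≠ e₂)
    (hγ₀ : ((((γ₀ : unitaryGroup (cmConjRingHom L) H').val : GL (Fin 3) L) : Matrix (Fin 3) (Fin 3) L) - e₁ • (1 : Matrix (Fin 3) (Fin 3) L)) *
      ((((γ₀ : unitaryGroup (cmConjRingHom L) H').val : GL (Fin 3) L) : Matrix (Fin 3) (Fin 3) L) - e₂ • (1 : Matrix (Fin 3) (Fin 3) L)) = 0)
    (hchar : (((γ₀ : unitaryGroup (cmConjRingHom L) H').val : GL (Fin 3) L) : Matrix (Fin 3) (Fin 3) L).charpoly =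
      (Polynomial.X - Polynomial.C e₁) ^ 2 * (Polynomial.X - Polynomial.C e₂))
    (γH : (UnitaryGroup.cmDatum L 2 (Matrix.of fun i j : Fin 2 => if i.val + j.val + 1 = 2 then (1 : L) else 0)).Rational ×
      (UnitaryGroup.cmDatum L 1 (Matrix.of fun i j : Fin 1 => if i.val + j.val + 1 = 1 then (1 : L) else 0)).Rational)
    (hγH₁ : (((γH.1 : unitaryGroup (cmConjRingHom L) (Matrix.of fun i j : Fin 2 => if i.val + j.val + 1 = 2 then (1 : L) else 0)).val : GL (Fin 2) L) :
        Matrix (Fin 2) (Fin 2) L) = e₁ • (1 : Matrix (Fin 2) (Fin 2) L))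
    (hγH₂ : (((γH.2 : unitaryGroup (cmConjRingHom L) (Matrix.of fun i j : Fin 1 => if i.val + j.val + 1 = 1 then (1 : L) else 0)).val : GL (Fin 1) L) :
        Matrix (Fin 1) (Fin 1) L) 0 0 = e₂)
    (v : HeightOneSpectrum (𝓞 ↥(maximalRealSubfield L))) :
    IsLocalNormPair L H' v
      ((UnitaryGroup.cmDatum L 2 (Matrix.of fun i j : Fin 2 => if i.val + j.val + 1 = 2 then (1 : L) else 0)).toLocal v
          ((UnitaryGroup.cmDatum L 2 (Matrix.of fun i j : Fin 2 => if i.val + j.val + 1 = 2 then (1 : L) else 0)).toAdelic γH.1),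
        (UnitaryGroup.cmDatum L 1 (Matrix.of fun i j : Fin 1 => if i.val + j.val + 1 = 1 then (1 : L) else 0)).toLocal v
          ((UnitaryGroup.cmDatum L 1 (Matrix.of fun i j : Fin 1 => if i.val + j.val + 1 = 1 then (1 : L) else 0)).toAdelic γH.2))
      ((UnitaryGroup.cmDatum L 3 H').toLocal v ((UnitaryGroup.cmDatum L 3 H').toAdelic γ₀)) :=
  isLocalNormPair_rationalComponent_toLocal_toAdelic (isNormPair_of_fst_eq_smul_one L H' γ₀ e₁ e₂ he hγ₀ hchar γH hγH₁ hγH₂) v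

/-- **ARCHIMEDEAN MATCHING AT THE SEMIREGULAR PAIR: `γ_H ⊗ 1 → γ₀ ⊗ 1`** (★ `IsArchNormPair L H′`: conjugate in `GL₃(L ⊗_ℚ ℝ)`), the components spelled as in
socket #15 (`cmRationalToArch` on `U(Φ₂)`, `U(Φ₁)`, `U(H′)`).  The global matching pushed along `GL₃(L) → GL₃(L ⊗ ℝ)` (★ `isArchNormPair_rationalArch_cmRationalToArch`).
Consumers: the archimedean halves of sockets #15 ∕ #17 and unit U6. [cite: Rogawski1990, §4.3 p. 44; §14.3 p. 234; §5.4 p. 78] -/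
theorem singularPairIsArchNormPair (γ₀ : (UnitaryGroup.cmDatum L 3 H').Rational) (e₁ e₂ : L) (he : e₁ ≠ e₂)
    (hγ₀ : ((((γ₀ : unitaryGroup (cmConjRingHom L) H').val : GL (Fin 3) L) : Matrix (Fin 3) (Fin 3) L) - e₁ • (1 : Matrix (Fin 3) (Fin 3) L)) *
      ((((γ₀ : unitaryGroup (cmConjRingHom L) H').val : GL (Fin 3) L) : Matrix (Fin 3) (Fin 3) L) - e₂ • (1 : Matrix (Fin 3) (Fin 3) L)) = 0)
    (hchar : (((γ₀ : unitaryGroup (cmConjRingHom L) H').val : GL (Fin 3) L) : Matrix (Fin 3) (Fin 3) L).charpoly =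
      (Polynomial.X - Polynomial.C e₁) ^ 2 * (Polynomial.X - Polynomial.C e₂))
    (γH : (UnitaryGroup.cmDatum L 2 (Matrix.of fun i j : Fin 2 => if i.val + j.val + 1 = 2 then (1 : L) else 0)).Rational ×
      (UnitaryGroup.cmDatum L 1 (Matrix.of fun i j : Fin 1 => if i.val + j.val + 1 = 1 then (1 : L) else 0)).Rational)
    (hγH₁ : (((γH.1 : unitaryGroup (cmConjRingHom L) (Matrix.of fun i j : Fin 2 => if i.val + j.val + 1 = 2 then (1 : L) else 0)).val : GL (Fin 2) L) :
        Matrix (Fin 2) (Fin 2) L) = e₁ • (1 : Matrix (Fin 2) (Fin 2) L))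
    (hγH₂ : (((γH.2 : unitaryGroup (cmConjRingHom L) (Matrix.of fun i j : Fin 1 => if i.val + j.val + 1 = 1 then (1 : L) else 0)).val : GL (Fin 1) L) :
        Matrix (Fin 1) (Fin 1) L) 0 0 = e₂) :
    IsArchNormPair L H'
      (cmRationalToArch L 2 (Matrix.of fun i j : Fin 2 => if i.val + j.val + 1 = 2 then (1 : L) else 0) γH.1,
        cmRationalToArch L 1 (Matrix.of fun i j : Fin 1 => if i.val + j.val + 1 = 1 then (1 : L) else 0) γH.2)
      (cmRationalToArch L 3 H' γ₀) :=
  isArchNormPair_rationalArch_cmRationalToArch (isNormPair_of_fst_eq_smul_one L H' γ₀ e₁ e₂ he hγ₀ hchar γH hγH₁ hγH₂)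

end Summit.HodgeConjecture.HodgeConjecture.Cruxes.H413.K2E4SingularPairIsLocalNormPair

end
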